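import Summits.Schanuel.Schanuel.Theorems.RootDecomp1KResidueDescent04

/-!
# RootDecomp1KExhibitDescent — lens 1, generation 69, NODE 29 «BOTH EXHIBITS OF RECORD FALL TO DESCENT» (×0-AS-RECORD, PRICE L3091; ERRATUM E6; CLAIM L3089, NODE L3094, VERDICT L3096): ρ1′ = `rho1'` = (Y + 1)(Y³ + x) − 17x² LEVEL-EMPTY for N ≥ 4 by the coprime SPLIT DESCENT + the digit mod 32 (class `splitC t c = (Y + t)(Y³ + x) − c·x²`, t = ±2^i, c an odd prime ≢ 1 mod 32: `no_level_splitC`, `thinFibreAt_rho1'`) and ρ2′ = `rho2'` = (Y² − 17x)² − x(Y + 1) LEVEL-FINITE by the SQUARE DESCENT p_N = □ + the tree's x-linear Ridout member (class `sqTopC c a b = (Y² − c·x)² + x(aY + b)`, c odd, b ≠ 0: `levelSet_sqTopC_subset ⊆ {N < 2} ∪ SqLevels b c`, `thinFibreAt_rho2'`); exhibits of record VACANT thereafter — part 1 (RootDecomp1KExhibitDescent01): §1  CLEARING AND SHAPING the six-coefficient quartic `Y⁴ + δ·Y³ + α·x·Y² + β·x·Y + ε·x + γ·x²` at `x = p/2^{2m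 · §2  SPLIT DESCENT — the class `S(t,c) = (Y + t)(Y³ + x) − c·x²` and the exhibit of record ρ1′ = `S(1,17)` — 10 declarations `int_eq6` … `levelFinite_split`

(lens-1 g69 NODE 29 «BOTH EXHIBITS OF RECORD FALL TO DESCENT» L3094: HOME kernel K = HOME/decomp-schanuel-lens-1/g69/lean/ExhibitDescent.lean sha256 b5df7c6e…, 777 l, 53 decls (50 theorems + 3 defs `splitC` / `SqLevels` / `sqTopC`), ONE namespace `Summit.Schanuel.Schanuel.Theorems.RootDecomp1KExhibitDescent`, imports the tree port …RootDecomp1KResidueDescent04 ONLY (node 28's record port; `rho1'` / `rho2'` / `residue_rho1'` / `residue_rho2'` / `pow_eight_mod` / `cube_mod` / `level_exponent` / `two_pow_dvd_psNumer_sub_one` / `levelFinite_xLinear` BY TREE NAME); no private / instance / set_option / notation / sorry / new axiom / binder, `decide` only on small literals; lens farm rc 0 · 0 errors · 0 sorries · 53 dupNamespace, `--axioms` standard ×20, Probe g69/out/Probe.lean 62ee5499… rc 0 (control ProbeCtrl rc 1 as it must), memo g69/NODE-g69.md; CLAIM L3089 (ASK-FIRST under K-R58 (iii)); crit g12 PRICE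 L3091: ×0-AS-RECORD («ρ1′ lever = DESCENT ∪ LOCAL SIEVING; ρ2′ lever = DESCENT ∪ the tree's isSquare_mul_psNumer_finite — a toolkit member»), CHECKLIST K-g69 (G1)–(G5) + (S), ERRATUM E6 PRE-ANNOUNCED ((E6-a) the census K-R51 (ii) descent-datum keys = the admission screen for exhibits; (E6-b) ρ1′ / ρ2′ leave the exhibit list at this port — exhibits VACANT; (E6-d) the critic's own erratum on VERDICT 28), W-29-1 (genus ≥ 2 guidance); writer g36 pre-check NOTE 1 L3093 (40/40); census INSTRUMENT NOTE 45 L3090 (the LIVENESS-v38/v39 keys on ρ1′ / ρ2′: jroot(3) not excluded, tors ∣ 3 / j2rat SOME, tors ∣ 4 — «K-R51 certificate INCOMPLETE» at nomination); (G2) deviation of record: K proves `isSquare_mul_psNumer_finite'` from the TREE's `levelFinite_xLinear (X^2) (−C e)` because the tree's `isSquare_mul_psNumer_finite` (DegreeLadder09) is outside the import closure; crit g12 VERDICT 29 L3096: «×0-AS-RECORD — BOOKED (no credit: exhibits, classes, cores); CHECKLIST K-g69 (G1)–(G5) + (S) MET, the (G2) deviation ACCEPTED; ERRATUM E6 — FIXED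 ((E6-a) the census descent-datum keys = the admission screen, with the census precision: xdeg-2 rows = the K-R51 (ii) battery ∧ not bi-pure ∧ DomZero ∧ typed ρ1/ρ2 residue member, xdeg ≥ 3 rows need the kit jac first; (E6-b) ρ1′ / ρ2′ LEAVE the exhibit list at this port and JOIN the unconditional part, EXHIBITS OF RECORD := VACANT (ρ1: vacant · ρ2: vacant); (E6-c) standing-witness ledger and tally UNCHANGED; (E6-d) the critic own erratum on VERDICT 28); TOOLKIT ∪= split descent {isCoprime_split, core_split, …splitC} and square descent {core_sq, level_sq_cases, SqLevels, …sqTopC, isSquare_mul_psNumer_finite′}; e29-1; PORT GO (STAGING NOTE 27 plan APPROVED AS STAGED)»; lens g69 RESULT/DONE L3097. Port by census-1 gen 25 as `RootDecomp1KExhibitDescent01–03` (files ≤ 400 lines; `--supports stmt-Schanuel-33364`, the item stays OPEN; ×0 record port, no credit anywhere; UNCONDITIONAL PART ∪= these names; E6: exhibits VACANT): 01 = K l.1–391 of the prepped source (opens §1 / §2) — 10 decls `int_eq6`, `shape6`, `noOddPrimeFactor_one`, …, `levelFinite_split`; 02 = K l.392–721 of the prepped source (opens # The exhibit of record ρ1′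 = `rho1'` = `S(1,17)` = `(Y + 1)(Y³ + x) − 17·x²` — DECIDED / §3 / # The exhibit of record ρ2′ = `rho2'` = `Q(17,−1,−1)` = `(Y² − 17x)² − x·Y − x` — DECIDED) — 36 decls `thinFibreAt_split`, `splitC`, `splitC_zero`, …, `rho2'_eq_sqTopC`; 03 = K l.722–774 of the prepped source (opens §4) — 7 decls `bev_rho2'_sq`, `levelSet_rho2'_subset`, `levelFinite_rho2'`, …, `exhibits_decided`. 0 one-line docstrings synthesised for undocumented helper declarations (statements quoted); everything else = K VERBATIM (statements, names, proofs, K's module docstring kept in part 01 below this provenance block).)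
-/

/-!
# RootDecomp1KExhibitDescent — lens 1, generation 69, NODE 29 «BOTH EXHIBITS OF RECORD FALL TO DESCENT»
(CLAIM L3089 · census INSTRUMENT NOTE 45 L3090 · PRICE L3091: ×0-AS-RECORD, PORT WELCOME, CHECKLIST K-g69 (G1)–(G5)
+ (S), ERRATUM E6 pre-announced — exhibits of record become VACANT when this node lands)

HOME kernel `K = HOME/decomp-schanuel-lens-1/g69/lean/ExhibitDescent.lean`, ONE namespace
`Summit.Schanuel.Schanuel.Theorems.RootDecomp1KExhibitDescent`, imports the tree port `…RootDecomp1KResidueDescent04` ONLY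
(node 28's record port, parts 01–04, LANDED: PORT LANDED 26 L3074 / PORT IDENTITY 28 L3075).  The exhibits of record
`rho1'`, `rho2'` (ERRATUM E5, VERDICT 28 L3071), their `bev` formulas `bev_rho1'`, `bev_rho2'`, the node-28 toolkit
`pow_eight_mod`, `cube_mod`, `level_exponent`, `two_pow_dvd_psNumer_sub_one`, `psNumer_two_pos_int`, `psNumer_two_lt_int`,
and the x-linear level finiteness `levelFinite_xLinear` (SectorTheorem10; node 2's engine, Ridout BY TREE NAME) are the
TREE's, used BY NAME; every declaration below is new (no re-typed tree declaration).  (G2)-NOTE: the tree's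
`isSquare_mul_psNumer_finite` (RootDecomp1KDegreeLadder09 l.52) is in NO module's import closure (no tree file imports
part 09), so — keeping ONE import, (S) — the square-set finiteness is re-derived here as `isSquare_mul_psNumer_finite'`
(every `e ≠ 0`, not only odd `c`) from the TREE's `levelFinite_xLinear` BY NAME: `e·p_N = k²` puts the point `k/2^m`
(`N! = 2m`) on the level `N` of `xLinP (X^2) (−C e)` at height `1 + 2e`; no Ridout re-proof, no binder.

WHAT IS PROVED (0 sorry, hypothesis-free):
* §1 `int_eq6` / `shape6` — the six-coefficient quartic `Y⁴ + δY³ + α·xY² + β·xY + ε·x + γ·x²` at a dyadic abscissa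
  `x = p/2^{2m}` (`γ`, `p` odd, `m ≥ 1`): a rational root has `den = 2^m`, odd numerator `W`, and `W` solves the REDUCED
  equation (node 28's `shape4` plus the `Y³`- and `x¹`-terms, which never attain the 2-adic minimum).
* §2 SPLIT DESCENT — `core_split`: `(W + t·2^m)(W³ + 2^m·p) = c·p²`, `c` an odd prime `≢ 1 (mod 32)`, `t` without odd
  prime factor, `m ≥ 5`, `2^m ∣ p − 1` ⟹ ⊥ (the two factors are coprime, hence `±c^a·□`; the digit `mod 32`).
  CLASS `S(t,c) = (Y+t)(Y³+x) − c·x²`: NO level point at any `N ≥ 4` (`no_level_split`), `LevelFinite`, `ThinFibreAt m₀`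
  for every `m₀` (coefficient-vector form `splitC t c`; `t ∈ {±2^i}` — `t = 0` is EXCLUDED by the hypothesis, it is
  node 28's `quartC`); MEMBER ρ1′ = `rho1'` = `S(1,17)` (`rho1'_eq_splitC`): `no_level_rho1' (4 ≤ N)`,
  `levelSet_rho1'_subset ⊆ {N < 4}`, `levelFinite_rho1'`, `thinFibreAt_rho1'`, `thinFibreAt_two_rho1'`,
  `bddLevelEmpty_rho1'`.
* §3 SQUARE DESCENT — `core_sq` (NO hypothesis on `c`): `(W² − c·p)² = −p·2^m·(aW + b·2^m)`, `p > 0` ⟹ the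
  degenerate branch `aW + b·2^m = 0 ∧ c·p = □`, or every odd prime `ℓ ∤ b` divides `p` to an EVEN power;
  `exists_odd_dvd_isSquare`: then `e·p = □` for an odd `e ∣ |b|`.  CLASS `Q(c,a,b) = (Y² − c·x)² + x·(aY + b)`, `c` ODD
  (not necessarily prime), `b ≠ 0`, `a` arbitrary: master lemma `level_sq_cases` (a level point at `N ≥ 2` ⟹ `a` even ∧
  `|c|·p_N = □`, or `e·p_N = □` for an odd `e ∣ |b|`), `LevelSet ⊆ {N ≤ 1} ∪ SqLevels b c` (`levelSet_sq_subset`; for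
  `a` odd the degenerate branch is void: `levelSet_sq_subset_odd`) — FINITE (`isSquare_mul_psNumer_finite'`,
  `sqLevels_finite`) — `levelFinite_sq`, `thinFibreAt_sq`, coefficient-vector form `sqTopC c a b`; MEMBER ρ2′ = `rho2'`
  = `Q(17,−1,−1)` (`rho2'_eq_sqTopC`): `levelSet_rho2'_subset : LevelSet (xPolyP 2 rho2') C ⊆ {N | N < 2} ∪
  {N | IsSquare (psNumer 2 N)}` (G2, sharp: `p_3 = psNumer 2 3 = 81 = 9²`), `levelFinite_rho2'`, `thinFibreAt_rho2'`,
  `thinFibreAt_two_rho2'`, `bddLevelEmpty_rho2'`.  §4 `exhibits_decided`: the conjunction of record.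
HONESTY: rung 0.  Both levers are Chevalley–Weil descents through a ℚ-rational torsion datum of the Jacobian (ρ1′:
`div(x·(Y+1)) = 3·D₀`, census `jroot(3)` not excluded; ρ2′: `Δ_x = (Y+1)(68Y²+Y+1)` reducible, census `j2rat` SOME) —
TOOLKIT OF RECORD (K-R50 (i) / K-R51 (i)).  Nothing here proves Schanuel, `FiniteOrderLiouvilleSchanuel` (33364),
`CoordLiouvilleSchanuel` (31077), `HyperLiouvilleSchanuel` (33363), `PolyDiophantineSchanuel` (31987), `ThinFibre 2`,
the standing witness W4, or a binder (`PadicSubspace`, `HeightComparison`, `SiegelShapes`).  No `private`, no `instance`,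
no `set_option`, no notation, no sorry, no axiom.
-/

noncomputable section

namespace Summit.Schanuel.Schanuel.Theorems.RootDecomp1KExhibitDescent

open Polynomial LiouvilleNumber
open scoped Nat
open Summit.Schanuel.Schanuel.Theorems.RootDecomp1KTwoBaseCell (psNumer partialSum_eq_psNumer_div coprime_psNumer)
open Summit.Schanuel.Schanuel.Theorems.RootDecomp1KDegreeLadder
open Summit.Schanuel.Schanuel.Theorems.RootDecomp1KXLinear (xLinP bev_xLinP thinFibreAt_xLinear)
open Summit.Schanuel.Schanuel.Theorems.RootDecomp1KXTop
open Summit.Schanuel.Schanuel.Theorems.RootDecomp1KLevelFinite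
open Summit.Schanuel.Schanuel.Theorems.RootDecomp1KOddEmpty (levelFinite_of_no_level)
open Summit.Schanuel.Schanuel.Theorems.RootDecomp1KHeightGrading (BddLevelEmpty bddLevelEmpty_iff_levelFinite)
open Summit.Schanuel.Schanuel.Theorems.RootDecomp1KDigitPincer (odd_psNumer_two two_pow_dvd_of_dvd_mul_odd)
open Summit.Schanuel.Schanuel.Theorems.RootDecomp1KTrinomialDescent (partialSum_two_eq_int_div)
open Summit.Schanuel.Schanuel.Theorems.RootDecomp1KRunge (psNumer_pos_runge)
open Summit.Schanuel.Schanuel.Theorems.RootDecomp1KSectorTheorem (Residue SectorCond rho1 rho2 levelFinite_xLinear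
  levelFinite_of_thinFibreAt_zero)
open Summit.Schanuel.Schanuel.Theorems.RootDecomp1KResidueDescent

/-! ## §1  CLEARING AND SHAPING the six-coefficient quartic `Y⁴ + δ·Y³ + α·x·Y² + β·x·Y + ε·x + γ·x²` at `x = p/2^{2m}` -/

/-- (P1′) the INTEGER level equation of `Y⁴ + δY³ + α·xY² + β·xY + ε·x + γ·x²` at `x = p/2^{2m}`, `Y = r = a/d`:
`a⁴2^{4m} + δa³d·2^{4m} + αp·a²d²·2^{2m} + βp·ad³·2^{2m} + εp·d⁴·2^{2m} + γp²d⁴ = 0`. -/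
theorem int_eq6 (δ α β ε γ p : ℤ) (m : ℕ) (r : ℚ)
    (h : (r : ℝ) ^ 4 + (δ : ℝ) * (r : ℝ) ^ 3 + (α : ℝ) * ((p : ℝ) / 2 ^ (2 * m)) * (r : ℝ) ^ 2
        + (β : ℝ) * ((p : ℝ) / 2 ^ (2 * m)) * r + (ε : ℝ) * ((p : ℝ) / 2 ^ (2 * m))
        + (γ : ℝ) * ((p : ℝ) / 2 ^ (2 * m)) ^ 2 = 0) :
    r.num ^ 4 * 2 ^ (4 * m) + δ * r.num ^ 3 * (r.den : ℤ) * 2 ^ (4 * m)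
      + α * p * r.num ^ 2 * (r.den : ℤ) ^ 2 * 2 ^ (2 * m)
      + β * p * r.num * (r.den : ℤ) ^ 3 * 2 ^ (2 * m) + ε * p * (r.den : ℤ) ^ 4 * 2 ^ (2 * m)
      + γ * p ^ 2 * (r.den : ℤ) ^ 4 = 0 := by
  have hnum : ((r.num : ℚ) : ℝ) = (r : ℝ) * (r.den : ℝ) := by
    have e : ((r * r.den : ℚ) : ℝ) = ((r.num : ℚ) : ℝ) := by rw [Rat.mul_den_eq_num]
    push_cast at e ⊢
    exact e.symm
  push_cast at hnum
  have hd : (0 : ℝ) < r.den := by exact_mod_cast r.den_pos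
  have h2 : (2 : ℝ) ^ (2 * m) ≠ 0 := pow_ne_zero _ two_ne_zero
  have key : ((r.num ^ 4 * 2 ^ (4 * m) + δ * r.num ^ 3 * (r.den : ℤ) * 2 ^ (4 * m)
      + α * p * r.num ^ 2 * (r.den : ℤ) ^ 2 * 2 ^ (2 * m)
      + β * p * r.num * (r.den : ℤ) ^ 3 * 2 ^ (2 * m) + ε * p * (r.den : ℤ) ^ 4 * 2 ^ (2 * m)
      + γ * p ^ 2 * (r.den : ℤ) ^ 4 : ℤ) : ℝ) =
      (r.den : ℝ) ^ 4 * ((2 : ℝ) ^ (2 * m)) ^ 2 * ((r : ℝ) ^ 4 + (δ : ℝ) * (r : ℝ) ^ 3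
        + (α : ℝ) * ((p : ℝ) / 2 ^ (2 * m)) * (r : ℝ) ^ 2
        + (β : ℝ) * ((p : ℝ) / 2 ^ (2 * m)) * r + (ε : ℝ) * ((p : ℝ) / 2 ^ (2 * m))
        + (γ : ℝ) * ((p : ℝ) / 2 ^ (2 * m)) ^ 2) := by
    push_cast
    rw [hnum, show (4 * m) = 2 * (2 * m) by ring, pow_mul']
    field_simp
  rw [h, mul_zero] at key
  exact_mod_cast key

/-- (P2′)+(P3′) **level shape**: for `γ`, `p` odd and `m ≥ 1`, an integer solution of the cleared six-coefficient
equation has `den r = 2^m`, `num r` odd, and `W := num r` solves the REDUCED equation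
`W⁴ + δ·2^m·W³ + α·p·W² + β·p·2^m·W + ε·p·(2^m)² + γ·p² = 0`. -/
theorem shape6 {δ α β ε γ p : ℤ} (hγ : Odd γ) (hp : Odd p) {m : ℕ} (hm : 1 ≤ m) {r : ℚ}
    (h : r.num ^ 4 * 2 ^ (4 * m) + δ * r.num ^ 3 * (r.den : ℤ) * 2 ^ (4 * m)
      + α * p * r.num ^ 2 * (r.den : ℤ) ^ 2 * 2 ^ (2 * m)
      + β * p * r.num * (r.den : ℤ) ^ 3 * 2 ^ (2 * m) + ε * p * (r.den : ℤ) ^ 4 * 2 ^ (2 * m)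
      + γ * p ^ 2 * (r.den : ℤ) ^ 4 = 0) :
    (r.den : ℤ) = 2 ^ m ∧ Odd r.num ∧
      r.num ^ 4 + δ * 2 ^ m * r.num ^ 3 + α * p * r.num ^ 2 + β * p * 2 ^ m * r.num
        + ε * p * (2 ^ m) ^ 2 + γ * p ^ 2 = 0 := by
  set a : ℤ := r.num with ha
  set d : ℕ := r.den with hd
  -- (P2′) d ∣ a⁴·2^{4m} and d ⊥ a ⟹ d = 2^e
  have hdvd : (d : ℤ) ∣ a ^ 4 * 2 ^ (4 * m) := by
    refine ⟨-(δ * a ^ 3 * 2 ^ (4 * m) + α * p * a ^ 2 * (d : ℤ) * 2 ^ (2 * m)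
      + β * p * a * (d : ℤ) ^ 2 * 2 ^ (2 * m) + ε * p * (d : ℤ) ^ 3 * 2 ^ (2 * m)
      + γ * p ^ 2 * (d : ℤ) ^ 3), ?_⟩
    linear_combination h
  have hred : Nat.Coprime d a.natAbs := Nat.coprime_comm.mp r.reduced
  have hcop : IsCoprime (d : ℤ) (a ^ 4) := by
    refine IsCoprime.pow_right ?_
    rw [Int.isCoprime_iff_nat_coprime]
    simpa using hred
  have hd2 : (d : ℤ) ∣ 2 ^ (4 * m) := hcop.dvd_of_dvd_mul_left hdvd
  have hd2' : d ∣ 2 ^ (4 * m) := by exact_mod_cast hd2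
  obtain ⟨e, -, hde⟩ := (Nat.dvd_prime_pow Nat.prime_two).1 hd2'
  have hdeZ : (d : ℤ) = 2 ^ e := by exact_mod_cast hde
  rw [hdeZ] at h
  -- `a` is odd as soon as `e ≥ 1`
  have hodd_of : 1 ≤ e → Odd a := fun he => by
    refine Int.not_even_iff_odd.mp fun hae => ?_
    have h2d : 2 ∣ d := by
      rw [hde]; exact dvd_pow_self 2 (by omega)
    have h2a : 2 ∣ a.natAbs := by
      have := Int.natAbs_dvd_natAbs.mpr (even_iff_two_dvd.mp hae)
      simpa using this
    exact Nat.not_coprime_of_dvd_of_dvd one_lt_two h2d h2a hred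
  -- (P3′) e = m
  have hem : e = m := by
    rcases Nat.lt_trichotomy e m with hlt | heq | hgt
    · -- e < m: γ·p² is even — absurd
      exfalso
      obtain ⟨t, rfl⟩ : ∃ t, m = e + 1 + t := ⟨m - e - 1, by omega⟩
      have key : ((2 : ℤ) ^ e) ^ 4 * (γ * p ^ 2 + 2 * (a ^ 4 * 2 ^ 3 * (2 ^ t) ^ 4
          + δ * a ^ 3 * 2 ^ e * 2 ^ 3 * (2 ^ t) ^ 4
          + α * p * a ^ 2 * 2 * (2 ^ t) ^ 2 + β * p * a * 2 ^ e * 2 * (2 ^ t) ^ 2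
          + ε * p * (2 ^ e) ^ 2 * 2 * (2 ^ t) ^ 2)) = 0 := by
        have e4 : (2 : ℤ) ^ (4 * (e + 1 + t)) = (2 ^ e) ^ 4 * 2 ^ 4 * (2 ^ t) ^ 4 := by
          rw [show 4 * (e + 1 + t) = e * 4 + 4 + t * 4 by ring, pow_add, pow_add, pow_mul, pow_mul]
        have e2 : (2 : ℤ) ^ (2 * (e + 1 + t)) = (2 ^ e) ^ 2 * 2 ^ 2 * (2 ^ t) ^ 2 := by
          rw [show 2 * (e + 1 + t) = e * 2 + 2 + t * 2 by ring, pow_add, pow_add, pow_mul, pow_mul]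
        rw [e4, e2] at h
        linear_combination h
      have h2e : ((2 : ℤ) ^ e) ^ 4 ≠ 0 := by positivity
      have hsum := (mul_eq_zero.mp key).resolve_left h2e
      have heven : Even (γ * p ^ 2) := ⟨-(a ^ 4 * 2 ^ 3 * (2 ^ t) ^ 4
          + δ * a ^ 3 * 2 ^ e * 2 ^ 3 * (2 ^ t) ^ 4
          + α * p * a ^ 2 * 2 * (2 ^ t) ^ 2 + β * p * a * 2 ^ e * 2 * (2 ^ t) ^ 2
          + ε * p * (2 ^ e) ^ 2 * 2 * (2 ^ t) ^ 2), by linear_combination hsum⟩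
      exact Int.not_even_iff_odd.mpr (hγ.mul (hp.pow)) heven
    · exact heq
    · -- e > m: a⁴ is even — absurd (a is odd since e ≥ 1)
      exfalso
      obtain ⟨t, rfl⟩ : ∃ t, e = m + 1 + t := ⟨e - m - 1, by omega⟩
      have key : ((2 : ℤ) ^ m) ^ 4 * (a ^ 4 + 2 * (δ * a ^ 3 * 2 ^ m * 2 ^ t
          + α * p * a ^ 2 * 2 * (2 ^ t) ^ 2
          + β * p * a * 2 ^ m * 2 ^ 2 * (2 ^ t) ^ 3 + ε * p * (2 ^ m) ^ 2 * 2 ^ 3 * (2 ^ t) ^ 4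
          + γ * p ^ 2 * 2 ^ 3 * (2 ^ t) ^ 4)) = 0 := by
        have e4 : (2 : ℤ) ^ (4 * m) = (2 ^ m) ^ 4 := by rw [pow_mul']
        have e2 : (2 : ℤ) ^ (2 * m) = (2 ^ m) ^ 2 := by rw [pow_mul']
        have e1 : (2 : ℤ) ^ (m + 1 + t) = 2 ^ m * 2 * 2 ^ t := by rw [pow_add, pow_add, pow_one]
        rw [e4, e2, e1] at h
        linear_combination h
      have h2m : ((2 : ℤ) ^ m) ^ 4 ≠ 0 := by positivity
      have hsum := (mul_eq_zero.mp key).resolve_left h2m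
      have heven : Even (a ^ 4) := ⟨-(δ * a ^ 3 * 2 ^ m * 2 ^ t
          + α * p * a ^ 2 * 2 * (2 ^ t) ^ 2
          + β * p * a * 2 ^ m * 2 ^ 2 * (2 ^ t) ^ 3 + ε * p * (2 ^ m) ^ 2 * 2 ^ 3 * (2 ^ t) ^ 4
          + γ * p ^ 2 * 2 ^ 3 * (2 ^ t) ^ 4), by linear_combination hsum⟩
      exact Int.not_even_iff_odd.mpr ((hodd_of (by omega)).pow) heven
  subst hem
  refine ⟨hdeZ, hodd_of hm, ?_⟩
  have key : ((2 : ℤ) ^ e) ^ 4 * (a ^ 4 + δ * 2 ^ e * a ^ 3 + α * p * a ^ 2 + β * p * 2 ^ e * a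
      + ε * p * (2 ^ e) ^ 2 + γ * p ^ 2) = 0 := by
    have e4 : (2 : ℤ) ^ (4 * e) = (2 ^ e) ^ 4 := by rw [pow_mul']
    have e2 : (2 : ℤ) ^ (2 * e) = (2 ^ e) ^ 2 := by rw [pow_mul']
    rw [e4, e2] at h
    linear_combination h
  have h2e : ((2 : ℤ) ^ e) ^ 4 ≠ 0 := by positivity
  exact (mul_eq_zero.mp key).resolve_left h2e

/-! ## §2  SPLIT DESCENT — the class `S(t,c) = (Y + t)(Y³ + x) − c·x²` and the exhibit of record ρ1′ = `S(1,17)` -/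

/-- `t = 1` has no odd prime factor (the shape `∀ q prime, q ∣ t → q = 2` used below; `t = ±2^i` or `t = 0`). -/
theorem noOddPrimeFactor_one : ∀ q : ℕ, q.Prime → (q : ℤ) ∣ 1 → q = 2 := fun q hq h => by
  have : (q : ℤ) ∣ 1 := h
  have hq1 : q = 1 := by exact_mod_cast Int.eq_one_of_dvd_one (by positivity) this
  exact absurd hq1 hq.one_lt.ne'

/-- `t = −1` has no odd prime factor. -/
theorem noOddPrimeFactor_neg_one : ∀ q : ℕ, q.Prime → (q : ℤ) ∣ (-1) → q = 2 := fun q hq h => by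
  have : (q : ℤ) ∣ 1 := (dvd_neg.mpr h : (q : ℤ) ∣ -(-1 : ℤ)) |>.trans (by norm_num)
  have hq1 : q = 1 := by exact_mod_cast Int.eq_one_of_dvd_one (by positivity) this
  exact absurd hq1 hq.one_lt.ne'

/-- `t = 2^i` has no odd prime factor. -/
theorem noOddPrimeFactor_two_pow (i : ℕ) : ∀ q : ℕ, q.Prime → (q : ℤ) ∣ (2 ^ i : ℤ) → q = 2 :=
  fun q hq h => by
  have h2 : (q : ℤ) ∣ 2 := (Nat.prime_iff_prime_int.mp hq).dvd_of_dvd_pow h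
  have : q ∣ 2 := by exact_mod_cast h2
  exact (Nat.prime_dvd_prime_iff_eq hq Nat.prime_two).mp this

/-- COPRIMALITY of the two split factors: if `(W + t·2^m)(W³ + 2^m·p) = c·p²` with `c` prime, `W` odd, `m ≥ 1` and `t`
without odd prime factor, then `W + t·2^m ⊥ W³ + 2^m·p`.  (A common prime `ℓ` divides `p` — directly, or because `ℓ = |c|`
forces `c² ∣ c·p²` — hence `ℓ ∣ t³·2^{3m}`, so `ℓ = 2`; but `W + t·2^m` is odd.) -/
theorem isCoprime_split {c t : ℤ} (hc : Prime c) (ht : ∀ q : ℕ, q.Prime → (q : ℤ) ∣ t → q = 2) {m : ℕ} (hm : 1 ≤ m) {W p : ℤ}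
    (hW : Odd W) (h : (W + t * 2 ^ m) * (W ^ 3 + 2 ^ m * p) = c * p ^ 2) :
    IsCoprime (W + t * 2 ^ m) (W ^ 3 + 2 ^ m * p) := by
  have hdodd : Odd (W + t * 2 ^ m) := by
    obtain ⟨j, rfl⟩ : ∃ j, m = j + 1 := ⟨m - 1, by omega⟩
    exact hW.add_even ⟨t * 2 ^ j, by ring⟩
  rw [Int.isCoprime_iff_nat_coprime]
  refine Nat.coprime_of_dvd fun k hk hkd hkd' => ?_
  have hkZd : (k : ℤ) ∣ W + t * 2 ^ m := Int.ofNat_dvd_left.mpr hkd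
  have hkZd' : (k : ℤ) ∣ W ^ 3 + 2 ^ m * p := Int.ofNat_dvd_left.mpr hkd'
  have hkp : Prime (k : ℤ) := Nat.prime_iff_prime_int.mp hk
  -- step 1: k ∣ p
  have hkZp : (k : ℤ) ∣ p := by
    have hkcp : (k : ℤ) ∣ c * p ^ 2 := by rw [← h]; exact dvd_mul_of_dvd_left hkZd _
    rcases hkp.dvd_or_dvd hkcp with hkc | hkp2
    · have hk' : k ∣ c.natAbs := Int.ofNat_dvd_left.mp hkc
      have hcn : Nat.Prime c.natAbs := Int.prime_iff_natAbs_prime.mp hc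
      rcases (Nat.dvd_prime hcn).mp hk' with h1 | h1
      · exact absurd h1 hk.one_lt.ne'
      · have hck : c ∣ (k : ℤ) := by rw [h1]; exact Int.dvd_natAbs.mpr (dvd_refl c)
        have hcd : c ∣ W + t * 2 ^ m := hck.trans hkZd
        have hcd' : c ∣ W ^ 3 + 2 ^ m * p := hck.trans hkZd'
        have hcc : c * c ∣ c * p ^ 2 := by rw [← h]; exact mul_dvd_mul hcd hcd'
        have hcp2 : c ∣ p ^ 2 := (mul_dvd_mul_iff_left hc.ne_zero).mp hcc
        exact hkc.trans (hc.dvd_of_dvd_pow hcp2)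
    · exact hkp.dvd_of_dvd_pow hkp2
  -- step 2: k ∣ t³·(2^m)³, hence k = 2
  have hkt : (k : ℤ) ∣ t ^ 3 * (2 ^ m) ^ 3 := by
    have e : t ^ 3 * ((2 : ℤ) ^ m) ^ 3 = (W + t * 2 ^ m) * ((W + t * 2 ^ m) ^ 2
        - 3 * t * 2 ^ m * (W + t * 2 ^ m) + 3 * t ^ 2 * (2 ^ m) ^ 2) - (W ^ 3 + 2 ^ m * p) + 2 ^ m * p := by
      ring
    rw [e]
    exact ((dvd_mul_of_dvd_left hkZd _).sub hkZd').add (dvd_mul_of_dvd_right hkZp _)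
  have hk2 : k = 2 := by
    rcases hkp.dvd_or_dvd hkt with h1 | h1
    · exact ht k hk (hkp.dvd_of_dvd_pow h1)
    · have h2 : (k : ℤ) ∣ 2 := hkp.dvd_of_dvd_pow (hkp.dvd_of_dvd_pow h1)
      have : k ∣ 2 := by exact_mod_cast h2
      exact (Nat.prime_dvd_prime_iff_eq hk Nat.prime_two).mp this
  subst hk2
  have h2d : (2 : ℤ) ∣ W + t * 2 ^ m := by exact_mod_cast hkZd
  exact Int.not_even_iff_odd.mpr hdodd (even_iff_two_dvd.mpr h2d)

/-- **SPLIT CORE** (the digit after the descent).  `(W + t·2^m)(W³ + 2^m·p) = c·p²` with `c` an odd prime,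
`32 ∤ c − 1`, `t` without odd prime factor, `m ≥ 5`, `W` odd, `p > 0`, `2^m ∣ p − 1` is IMPOSSIBLE: the coprime factors
are `c·d₁, d'` (or `d, c·d₁'`) with `d₁·d' = p²` coprime, so `d₁ = ±□`, and reading `W ≡ c·d₁`, `W³ ≡ d'`, `p ≡ 1`
modulo `2^m` gives `c³·d₁⁴ ≡ 1`, i.e. `c³ ≡ 1 (mod 32)` (`d₁⁴ = P⁸ ≡ 1`), whence `c ≡ 1 (mod 32)` — resp. `c ≡ d⁴ ≡ 1`. -/
theorem core_split {c t : ℤ} (hc : Prime c) (h32 : ¬ (32 : ℤ) ∣ c - 1) (ht : ∀ q : ℕ, q.Prime → (q : ℤ) ∣ t → q = 2)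
    {m : ℕ} (hm : 5 ≤ m) {W p : ℤ} (hW : Odd W) (hp0 : 0 < p) (hp1 : (2 : ℤ) ^ m ∣ p - 1)
    (h : (W + t * 2 ^ m) * (W ^ 3 + 2 ^ m * p) = c * p ^ 2) : False := by
  have h32m : (32 : ℤ) ∣ 2 ^ m := by
    obtain ⟨j, rfl⟩ : ∃ j, m = 5 + j := ⟨m - 5, by omega⟩
    exact ⟨2 ^ j, by rw [pow_add]; norm_num⟩
  have hm1 : 1 ≤ m := by omega
  have hdodd : Odd (W + t * 2 ^ m) := by
    obtain ⟨j, rfl⟩ : ∃ j, m = j + 1 := ⟨m - 1, by omega⟩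
    exact hW.add_even ⟨t * 2 ^ j, by ring⟩
  have hcop := isCoprime_split hc ht hm1 hW h
  have hcdd : c ∣ (W + t * 2 ^ m) * (W ^ 3 + 2 ^ m * p) := ⟨p ^ 2, h⟩
  have hp0' : p ≠ 0 := hp0.ne'
  haveI : NeZero (2 ^ m : ℕ) := ⟨pow_ne_zero _ two_ne_zero⟩
  have cast2m : ((2 ^ m : ℕ) : ℤ) = 2 ^ m := by push_cast; rfl
  -- the three congruences modulo 2^m, as equalities in `ZMod (2^m)`
  have zW : ((W : ℤ) : ZMod (2 ^ m)) = ((W + t * 2 ^ m : ℤ) : ZMod (2 ^ m)) := by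
    rw [ZMod.intCast_eq_intCast_iff_dvd_sub, cast2m]
    exact ⟨t, by ring⟩
  have zW3 : ((W : ℤ) : ZMod (2 ^ m)) ^ 3 = ((W ^ 3 + 2 ^ m * p : ℤ) : ZMod (2 ^ m)) := by
    rw [← Int.cast_pow, ZMod.intCast_eq_intCast_iff_dvd_sub, cast2m]
    exact ⟨p, by ring⟩
  have zp : ((p : ℤ) : ZMod (2 ^ m)) = 1 := by
    have : ((p : ℤ) : ZMod (2 ^ m)) = ((1 : ℤ) : ZMod (2 ^ m)) := by
      rw [ZMod.intCast_eq_intCast_iff_dvd_sub, cast2m]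
      have : (2 : ℤ) ^ m ∣ -(p - 1) := dvd_neg.mpr hp1
      simpa using this
    simpa using this
  rcases hc.dvd_or_dvd hcdd with hcd | hcd'
  · -- CASE A: c ∣ d, d = c·d₁, d₁·d' = p²
    obtain ⟨d₁, hd₁⟩ := hcd
    have hprod : d₁ * (W ^ 3 + 2 ^ m * p) = p ^ 2 := by
      have : c * (d₁ * (W ^ 3 + 2 ^ m * p)) = c * p ^ 2 := by rw [← h, hd₁]; ring
      exact mul_left_cancel₀ hc.ne_zero this
    have hcop₁ : IsCoprime d₁ (W ^ 3 + 2 ^ m * p) := by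
      rw [hd₁] at hcop; exact hcop.of_mul_left_right
    obtain ⟨P, hP⟩ := Int.sq_of_isCoprime hcop₁ hprod
    have hd14 : d₁ ^ 4 = P ^ 8 := by rcases hP with hP | hP <;> rw [hP] <;> ring
    have hd₁odd : Odd d₁ := by rw [hd₁] at hdodd; exact (Int.odd_mul.mp hdodd).2
    have hPodd : Odd P := by
      have : Odd (P ^ 8) := hd14 ▸ hd₁odd.pow
      exact (Int.odd_pow.mp this).resolve_right (by norm_num)
    have key : (((c ^ 3 * P ^ 8 - 1 : ℤ)) : ZMod (2 ^ m)) = 0 := by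
      have zW' : ((W : ℤ) : ZMod (2 ^ m)) = c * d₁ := by rw [zW, hd₁]; push_cast; ring
      have zprod : ((d₁ : ℤ) : ZMod (2 ^ m)) * ((W ^ 3 + 2 ^ m * p : ℤ) : ZMod (2 ^ m)) = (p : ZMod (2 ^ m)) ^ 2 := by
        rw [← Int.cast_mul, hprod]; push_cast; ring
      have zP : ((d₁ : ℤ) : ZMod (2 ^ m)) ^ 4 = (P : ZMod (2 ^ m)) ^ 8 := by
        rw [← Int.cast_pow, hd14]; push_cast; ring
      push_cast
      linear_combination (-((d₁ : ZMod (2 ^ m)) * (((c : ZMod (2 ^ m)) * d₁) ^ 2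
        + (c : ZMod (2 ^ m)) * d₁ * W + (W : ZMod (2 ^ m)) ^ 2))) * zW' + (d₁ : ZMod (2 ^ m)) * zW3 + zprod
        + ((p : ZMod (2 ^ m)) + 1) * zp - (c : ZMod (2 ^ m)) ^ 3 * zP
    have hdvd : (2 : ℤ) ^ m ∣ c ^ 3 * P ^ 8 - 1 := by
      have := (ZMod.intCast_zmod_eq_zero_iff_dvd _ _).mp key
      rwa [cast2m] at this
    have h1 : (32 : ℤ) ∣ c ^ 3 * P ^ 8 - 1 := h32m.trans hdvd
    have h2 : (32 : ℤ) ∣ P ^ 8 - 1 := pow_eight_mod P hPodd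
    have h3 : (32 : ℤ) ∣ c ^ 3 - 1 := by
      have e : c ^ 3 - 1 = (c ^ 3 * P ^ 8 - 1) - c ^ 3 * (P ^ 8 - 1) := by ring
      rw [e]; exact dvd_sub h1 (dvd_mul_of_dvd_right h2 _)
    exact h32 (cube_mod c h3)
  · -- CASE B: c ∣ d', d' = c·d₁', d·d₁' = p²
    obtain ⟨d₁, hd₁⟩ := hcd'
    have hprod : (W + t * 2 ^ m) * d₁ = p ^ 2 := by
      have : c * ((W + t * 2 ^ m) * d₁) = c * p ^ 2 := by rw [← h, hd₁]; ring
      exact mul_left_cancel₀ hc.ne_zero this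
    have hcop₁ : IsCoprime (W + t * 2 ^ m) d₁ := by
      rw [hd₁] at hcop; exact hcop.of_mul_right_right
    obtain ⟨P, hP⟩ := Int.sq_of_isCoprime hcop₁ hprod
    have hd4 : (W + t * 2 ^ m) ^ 4 = P ^ 8 := by rcases hP with hP | hP <;> rw [hP] <;> ring
    have hPodd : Odd P := by
      have : Odd (P ^ 8) := hd4 ▸ hdodd.pow
      exact (Int.odd_pow.mp this).resolve_right (by norm_num)
    have key : (((P ^ 8 - c : ℤ)) : ZMod (2 ^ m)) = 0 := by
      have zW3' : ((W : ℤ) : ZMod (2 ^ m)) ^ 3 = c * d₁ := by rw [zW3, hd₁]; push_cast; ring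
      have zprod : ((W + t * 2 ^ m : ℤ) : ZMod (2 ^ m)) * (d₁ : ZMod (2 ^ m)) = (p : ZMod (2 ^ m)) ^ 2 := by
        rw [← Int.cast_mul, hprod]; push_cast; ring
      have zP : ((W + t * 2 ^ m : ℤ) : ZMod (2 ^ m)) ^ 4 = (P : ZMod (2 ^ m)) ^ 8 := by
        rw [← Int.cast_pow, hd4]; push_cast; ring
      set D : ZMod (2 ^ m) := ((W + t * 2 ^ m : ℤ) : ZMod (2 ^ m)) with hD
      push_cast
      linear_combination (-(D * (D ^ 2 + D * W + (W : ZMod (2 ^ m)) ^ 2))) * zW + D * zW3'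
        + (c : ZMod (2 ^ m)) * zprod + ((c : ZMod (2 ^ m)) * ((p : ZMod (2 ^ m)) + 1)) * zp - zP
    have hdvd : (2 : ℤ) ^ m ∣ P ^ 8 - c := by
      have := (ZMod.intCast_zmod_eq_zero_iff_dvd _ _).mp key
      rwa [cast2m] at this
    have h1 : (32 : ℤ) ∣ P ^ 8 - c := h32m.trans hdvd
    have h2 : (32 : ℤ) ∣ P ^ 8 - 1 := pow_eight_mod P hPodd
    have h3 : (32 : ℤ) ∣ c - 1 := by
      have e : c - 1 = (P ^ 8 - 1) - (P ^ 8 - c) := by ring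
      rw [e]; exact dvd_sub h2 h1
    exact h32 h3

/-- **NO LEVEL POINT at any level `N ≥ 4`** for every presentation `P` of the split class
`S(t,c) = (Y + t)(Y³ + x) − c·x²` (`bev P x y = y⁴ + t·y³ + x·y + t·x − c·x²`), `c` an odd prime with `32 ∤ c − 1`,
`t` without odd prime factor — hypothesis-free (no Ridout, no Subspace theorem, no binder). -/
theorem no_level_split {c t : ℤ} (hc : Prime c) (hodd : Odd c) (h32 : ¬ (32 : ℤ) ∣ c - 1) (ht : ∀ q : ℕ, q.Prime → (q : ℤ) ∣ t → q = 2)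
    {P : ℤ[X][X]} (hP : ∀ x y, bev P x y = y ^ 4 + t * y ^ 3 + x * y + t * x - c * x ^ 2)
    {N : ℕ} (hN : 4 ≤ N) (r : ℚ) : bev P (partialSum 2 N) r ≠ 0 := by
  intro h
  obtain ⟨m, hNm, hm1, hmle, h4⟩ := level_exponent (show 2 ≤ N by omega)
  obtain ⟨hm12, -⟩ := h4 hN
  set p : ℤ := (psNumer 2 N : ℤ) with hpdef
  have hp_odd : Odd p := odd_psNumer_two (by omega)
  have hp0 : 0 < p := psNumer_two_pos_int N
  have hp1 : (2 : ℤ) ^ m ∣ p - 1 := (pow_dvd_pow 2 hmle).trans (two_pow_dvd_psNumer_sub_one (by omega))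
  have hx : partialSum 2 N = (p : ℝ) / 2 ^ (2 * m) := by rw [partialSum_two_eq_int_div, hNm]
  rw [hP, hx] at h
  have hint := int_eq6 t 0 1 t (-c) p m r (by push_cast; linear_combination h)
  obtain ⟨-, hW, hred⟩ := shape6 (by simpa using hodd.neg) hp_odd hm1 hint
  exact core_split hc h32 ht (by omega) hW hp0 hp1 (W := r.num) (by linear_combination hred)

/-- `LevelSet P C ⊆ {N < 4}` for every presentation `P` of `S(t,c)`. -/
theorem levelSet_split_subset {c t : ℤ} (hc : Prime c) (hodd : Odd c) (h32 : ¬ (32 : ℤ) ∣ c - 1)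
    (ht : ∀ q : ℕ, q.Prime → (q : ℤ) ∣ t → q = 2) {P : ℤ[X][X]}
    (hP : ∀ x y, bev P x y = y ^ 4 + t * y ^ 3 + x * y + t * x - c * x ^ 2) (C : ℝ) :
    LevelSet P C ⊆ {N | N < 4} := by
  rintro N ⟨r, -, h, -⟩
  by_contra hN
  exact no_level_split hc hodd h32 ht hP (by simpa using hN) r h

/-- **`LevelFinite` for the split class** — hypothesis-free. -/
theorem levelFinite_split {c t : ℤ} (hc : Prime c) (hodd : Odd c) (h32 : ¬ (32 : ℤ) ∣ c - 1)
    (ht : ∀ q : ℕ, q.Prime → (q : ℤ) ∣ t → q = 2) {P : ℤ[X][X]}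
    (hP : ∀ x y, bev P x y = y ^ 4 + t * y ^ 3 + x * y + t * x - c * x ^ 2) : LevelFinite P := fun C =>
  (Set.finite_lt_nat 4).subset (levelSet_split_subset hc hodd h32 ht hP C)

end Summit.Schanuel.Schanuel.Theorems.RootDecomp1KExhibitDescent
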